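import Mathlib
import Literature.Computability.Complexity.BinomialTV
import Summits.PneNP.PneNP.Theorems.KarlinRubinMonotoneSufficesTransportBinomial
import Summits.PneNP.PneNP.Theorems.KarlinRubinMonotoneSufficesTransportSlices

/-!
# Crux `MonotoneSuffices` (stmt-PneNP-18026), line `Sketch` — density-shift rung, stub
# `stub_shiftTail` (W2): the shifted law puts little mass on the high slices

In the density-shift rung the input `x : α → Bool` (uniform) is replaced by the up-shift
`x ∨ 1_R` for a uniformly random `r`-subset `R` of the `N = |α|` slots; the number of pairs
`(x, R)` over a fixed `y` is `2^r · C(#supp y, r)`, so the shifted law weighs the slice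
`m = #supp y` by `2^r C(N, m) C(m, r) / (C(N, r) 2^N) = C(N - r, m - r) / 2^(N - r)`, i.e. it is
`r + Bin(N - r, 1/2)`.  This file bounds its mass ABOVE the slice `N/2 + u` (`r ≤ u`), where the
likelihood ratio against the uniform law is not controlled:

`2^r · ∑_{y : N/2 + u < #supp y} C(#supp y, r) ≤ C(N, r) · 2^N · N / (u - r + 1)²`.

Proof: group `y` by its weight `m` (`shiftTail_sum_slices`, the slice `m` has `C(N, m)` elements,
`SliceTransport.card_slice_eq_choose`); the subset-of-a-subset identity
`C(N, m) C(m, r) = C(N, r) C(N - r, m - r)` (`Nat.choose_mul`); reindex `j = m - r`, enlarging the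
index set to `j ≥ (N - r)/2 + (u - r + 1)` (`shiftTail_sum_shift_le`); and Chebyshev for the
symmetric binomial law `Bin(N - r, 1/2)` (`SliceTransport.sum_b_le_of_half_add_le`,
`shiftTail_sum_tail_le`).
-/

set_option linter.dupNamespace false -- `Summit.PneNP.PneNP.…`: summit = sub-problem name (D-0017)

namespace Summit.PneNP.PneNP.Theorems.MonotoneSuffices.DensityShift

open Finset Literature.Computability.Complexity.BinomialTV

/-! ### Grouping the cube by weight -/

/-- **Grouping by weight**: a weight statistic `F (#supp y)` summed over the vectors `y` of weight
`> N/2 + u` is `∑_{N/2 + u < m ≤ N} C(N, m) F m`. [folklore] -/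
theorem shiftTail_sum_slices {α : Type*} [Fintype α] [DecidableEq α] (u : ℕ)
    (F : ℕ → ℝ) :
    ∑ y ∈ (univ : Finset (α → Bool)).filter
        (fun y => Fintype.card α / 2 + u < #(univ.filter fun a => y a = true)),
        F #(univ.filter fun a => y a = true) =
      ∑ m ∈ (range (Fintype.card α + 1)).filter (fun m => Fintype.card α / 2 + u < m),
        ((Fintype.card α).choose m : ℝ) * F m := by
  set S := (univ : Finset (α → Bool)).filter
      (fun y => Fintype.card α / 2 + u < #(univ.filter fun a => y a = true)) with hS
  set T := (range (Fintype.card α + 1)).filter (fun m => Fintype.card α / 2 + u < m) with hT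
  have hmaps : ∀ y ∈ S, #(univ.filter fun a => y a = true) ∈ T := fun y hy => by
    rw [hT, mem_filter, mem_range]
    exact ⟨Nat.lt_succ_of_le (card_le_univ _), (mem_filter.1 hy).2⟩
  refine (sum_fiberwise_of_maps_to' hmaps F).symm.trans (sum_congr rfl fun m hm => ?_)
  -- on the fibre over `m ∈ T` the condition defining `S` is automatic
  have hfib : S.filter (fun y => #(univ.filter fun a => y a = true) = m) =
      univ.filter (fun y : α → Bool => #(univ.filter fun a => y a = true) = m) := by
    ext y
    simp only [hS, mem_filter, mem_univ, true_and]
    exact ⟨fun hy => hy.2, fun hym => ⟨by rw [hym]; exact (mem_filter.1 hm).2, hym⟩⟩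
  rw [sum_const, hfib, SliceTransport.card_slice_eq_choose, nsmul_eq_mul]

/-! ### Reindexing and the binomial tail -/

/-- **Reindexing `j = m - r`** (enlarging the index set): for `g ≥ 0`,
`∑_{N/2 + (r + d) < m ≤ N} g (m - r) ≤ ∑_{(N - r)/2 + (d + 1) ≤ j ≤ N - r} g j`, since
`(N - r)/2 ≤ N/2` and `m ↦ m - r` is injective above `r`. [folklore] -/
theorem shiftTail_sum_shift_le (N r d : ℕ) (g : ℕ → ℝ) (hg : ∀ j, 0 ≤ g j) :
    ∑ m ∈ (range (N + 1)).filter (fun m => N / 2 + (r + d) < m), g (m - r) ≤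
      ∑ j ∈ (range (N - r + 1)).filter (fun j => (N - r) / 2 + (d + 1) ≤ j), g j := by
  set T := (range (N + 1)).filter (fun m => N / 2 + (r + d) < m) with hT
  have hinj : Set.InjOn (fun m => m - r) T := by
    intro m₁ hm₁ m₂ hm₂ h
    rw [hT, coe_filter, Set.mem_setOf_eq, mem_range] at hm₁ hm₂
    simp only at h
    omega
  calc ∑ m ∈ T, g (m - r) = ∑ j ∈ T.image (fun m => m - r), g j := (sum_image hinj).symm
    _ ≤ _ := by
        refine sum_le_sum_of_subset_of_nonneg (fun j hj => ?_) fun j _ _ => hg j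
        rw [mem_image] at hj
        obtain ⟨m, hm, rfl⟩ := hj
        rw [hT, mem_filter, mem_range] at hm
        rw [mem_filter, mem_range]
        omega

/-- **Chebyshev for `Bin(M, 1/2)`, counting form**:
`∑_{M/2 + (d + 1) ≤ j ≤ M} C(M, j) ≤ 2^M · M/(d + 1)²`
(`SliceTransport.sum_b_le_of_half_add_le` with `b M j = C(M, j)/2^M`). [folklore] -/
theorem shiftTail_sum_tail_le (M d : ℕ) :
    ∑ j ∈ (range (M + 1)).filter (fun j => M / 2 + (d + 1) ≤ j), ((M.choose j : ℕ) : ℝ)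
      ≤ 2 ^ M * ((M : ℝ) / ((d : ℝ) + 1) ^ 2) := by
  have h := SliceTransport.sum_b_le_of_half_add_le M (t := d + 1) (Nat.succ_pos d)
  push_cast at h
  have hb : ∑ j ∈ (range (M + 1)).filter (fun j => M / 2 + (d + 1) ≤ j),
        ((M.choose j : ℕ) : ℝ) =
      2 ^ M * ∑ j ∈ (range (M + 1)).filter (fun j => M / 2 + (d + 1) ≤ j), b M j := by
    rw [mul_sum]
    refine sum_congr rfl fun j _ => ?_
    rw [b, mul_div_cancel₀ _ (by positivity)]
  rw [hb]
  exact mul_le_mul_of_nonneg_left h (by positivity)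

/-- **The weighted slice tail**:
`2^r ∑_{N/2 + (r + d) < m ≤ N} C(N, m) C(m, r) ≤ C(N, r) 2^N N/(d + 1)²`. [folklore] -/
theorem shiftTail_weighted_sum_le (N r d : ℕ) :
    (2 : ℝ) ^ r * ∑ m ∈ (range (N + 1)).filter (fun m => N / 2 + (r + d) < m),
        (N.choose m : ℝ) * (m.choose r : ℝ) ≤
      (N.choose r : ℝ) * 2 ^ N * ((N : ℝ) / ((d : ℝ) + 1) ^ 2) := by
  rcases lt_or_ge N r with hNr | hrN
  · -- `r > N`: every term vanishes
    have h0 : ∑ m ∈ (range (N + 1)).filter (fun m => N / 2 + (r + d) < m),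
        (N.choose m : ℝ) * (m.choose r : ℝ) = 0 := by
      refine sum_eq_zero fun m hm => ?_
      rw [mem_filter, mem_range] at hm
      rw [Nat.choose_eq_zero_of_lt (by omega : m < r), Nat.cast_zero, mul_zero]
    rw [h0, mul_zero]
    positivity
  · obtain ⟨M, rfl⟩ := Nat.exists_eq_add_of_le hrN
    -- subset of a subset: `C(N, m) C(m, r) = C(N, r) C(N - r, m - r)`
    have h1 : ∀ m ∈ (range (r + M + 1)).filter (fun m => (r + M) / 2 + (r + d) < m),
        ((r + M).choose m : ℝ) * (m.choose r : ℝ) =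
          ((r + M).choose r : ℝ) * (M.choose (m - r) : ℝ) := by
      intro m hm
      rw [mem_filter, mem_range] at hm
      have h := Nat.choose_mul (n := r + M) (k := m) (s := r) (by omega)
      rw [Nat.add_sub_cancel_left] at h
      exact_mod_cast h
    rw [sum_congr rfl h1, ← mul_sum]
    have h2 :=
      shiftTail_sum_shift_le (r + M) r d (fun j => (M.choose j : ℝ)) fun j => by positivity
    rw [Nat.add_sub_cancel_left] at h2
    have h3 := shiftTail_sum_tail_le M d
    have hM : (M : ℝ) ≤ ((r + M : ℕ) : ℝ) := by exact_mod_cast Nat.le_add_left M r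
    calc _ ≤ (2 : ℝ) ^ r * (((r + M).choose r : ℝ) *
            (2 ^ M * ((M : ℝ) / ((d : ℝ) + 1) ^ 2))) := by
          gcongr
          exact h2.trans h3
      _ = ((r + M).choose r : ℝ) * 2 ^ (r + M) * ((M : ℝ) / ((d : ℝ) + 1) ^ 2) := by
          rw [pow_add]; ring
      _ ≤ ((r + M).choose r : ℝ) * 2 ^ (r + M) *
            (((r + M : ℕ) : ℝ) / ((d : ℝ) + 1) ^ 2) := by
          gcongr

/-! ### The stub -/

/-- **stub_shiftTail** (registered stub W2 of stmt-PneNP-18026, line `Sketch`, density-shift rung):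
after an `r`-up-shift the mass above the slice `N/2 + u` (`r ≤ u`) is a binomial tail,
`2^r ∑_{y : N/2 + u < #supp y} C(#supp y, r) ≤ C(N, r) 2^N · N/(u - r + 1)²`. [folklore] -/
theorem stub_shiftTail :
    ∀ {α : Type*} [Fintype α] [DecidableEq α] (r u : ℕ), r ≤ u →
      (2 : ℝ) ^ r * ∑ y ∈ (univ : Finset (α → Bool)).filter
          (fun y => Fintype.card α / 2 + u < #(univ.filter fun a => y a = true)),
            ((#(univ.filter fun a => y a = true)).choose r : ℝ) ≤
        ((Fintype.card α).choose r : ℝ) * 2 ^ Fintype.card α *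
          ((Fintype.card α : ℝ) / ((u : ℝ) - r + 1) ^ 2) := by
  intro α _ _ r u hru
  obtain ⟨d, rfl⟩ := Nat.exists_eq_add_of_le hru
  have hcast : ((r + d : ℕ) : ℝ) - r + 1 = (d : ℝ) + 1 := by
    push_cast
    ring
  rw [hcast, shiftTail_sum_slices (α := α) (r + d) (fun m => (m.choose r : ℝ))]
  exact shiftTail_weighted_sum_le (Fintype.card α) r d

end Summit.PneNP.PneNP.Theorems.MonotoneSuffices.DensityShift
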